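/-
Copyright: lit-balaban Phase-2 proof seat p30 (gen 26).  Statement-level skeleton of a published paper; no proof claims beyond what the
kernel checks below.
-/
import Literature.MathematicalPhysics.QuantumFieldTheory.BalabanImbrieJaffe1984to88.BIJ85CentredAxialGauge

/-!
# [BalabanImbrieJaffe1985] §7.3 p. 326 / [Balaban1985Averaging] pp. 24–25 — **the tree gauge of a torus ball rooted along an
# arbitrary axis direction: bond deviations controlled by the distance to the AXIS** (the bi-centred linear gauge of the two-point
# (Hölder) interior estimate: small at both bonds of an axis-parallel pair)

T. Bałaban, J. Imbrie, A. Jaffe, *Renormalization of the Higgs model: minimizers, propagators and the stability of mean field theory*,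
Commun. Math. Phys. **97** (1985) 299–329 [BalabanImbrieJaffe1985], §7.3 p. 326 [PDF 28] (*"by change of gauge u_k can be transformed in a
local region Λ into a configuration of the form exp[ie_kηA], where A is smooth and small"*); the tree ("axial") gauge and its bond estimate
`V₀(x, x+e₁) = 1, |V₀(x, x+e₂) − 1| < |x₁ − y₁|α₀, …` = T. Bałaban, *Averaging operations for lattice gauge theories*, Commun. Math. Phys.
**98** (1985) 17–51 [Balaban1985Averaging], p. 24 l. −2 – p. 25 l. 3.

statement-level skeleton of published theorems with citation tags; proofs where landed; nothing here is a claim about the Yang–Mills mass gap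

CITATION HEADER (lean-in-tree rule).  Part of the lit-balaban TYPED SKELETON (HOME `run/shared/lean/pub/lit-balaban/`), PHASE-2 proof seat
p30 gen 26 (unit `lit-balaban-p30-g26`; TAKING line HOME/STATUS.md 2026-08-23T01:01:50Z; free-target protocol G.5-34(d) — the Hölder
residual of item 3 of `HOME/lit-balaban-r15/C1-CLOSURE.md` §5, owner r15).  WHAT THIS FILE IS: a located input of the [7] (1.9) Hölder member
for row **C1.Eq7.3.1-7.3.2** of `HOME/lit-balaban-r15/ROWS-C1.md` (no head effect): the REFINEMENT of this cell's p344214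
(`BIJ85CentredAxialGauge.dist1_centredGauge_le`: in the tree gauge of a torus ball centred at `x₀` every bond deviation is
`≤ (d−1)|z − x₀|_∞·δ`) needed when TWO bonds `⟨x₀, x₀+e_μ⟩`, `⟨x₁, x₁+e_μ⟩` with `x₁ = x₀ + ρe_i` are estimated in ONE gauge (the Hölder
difference of [Balaban1983RegularityDecay] (1.9)): the print's sharp bound (p. 25 l. 1–3: the deviation of `V₀(x, x+e_μ)` involves only the
coordinates `x_κ − y_κ` of the directions changed AFTER `μ` along the tree) says that, for the tree whose FIRST segment runs along the axis
`i`, the deviation is controlled by the distance of `z` to the AXIS LINE `x₀ + ℤe_i` — hence by `min(|z − x₀|_∞, |z − x₁|_∞)` for every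
`x₁` on that axis: the gauge is small near BOTH bonds.  T4/p344214 fix the tree order (`treeWord`: directions `d, d−1, …, 1`, the root axis
being the last coordinate); §1 transports the group-level bound to an arbitrary root direction `i` by RELABELLING THE COORDINATES (the
transposition `i ↔ d−1` applied to sites, directions and the field — pure bookkeeping, the field is arbitrary), §2 transfers it to the torus
exactly as p344214 §§2–3 do.  Model-level theorems about a concrete definition (`centredGaugeDir`); no `Prop` placeholder; no analytic
estimate beyond the print's.

THE RESULT.  `dist1_centredGaugeDir_le`: if `dist1 (U(∂p)) ≤ δ` for every plaquette of the torus `T^{(j)}` and the ball of sup-radius `R`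
around `x₀` does not wrap (`2R + 4 < sitesPerDir j`), then in the gauge `h = centredGaugeDir U x₀ R i` every bond `⟨z, z+e_μ⟩` with
`|z − x₀|_∞ ≤ R` satisfies `dist1 (U^h(⟨z, μ⟩)) ≤ δ·Σ_{ν ≠ i} cdist(z_ν − x₀,ν) ≤ (d−1)·δ·max_{ν≠i} cdist(z_ν − x₀,ν)`; corollary
`dist1_centredGaugeDir_le_min`: for every `x₁` with `x₁,ν = x₀,ν (ν ≠ i)`, `dist1 (U^h(⟨z, μ⟩)) ≤ (d−1)·δ·min(|z − x₀|_∞, |z − x₁|_∞)`.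

HONEST SCOPE.  General gauge group with an invariant distance (`GaugeGroup`), any `d ≥ 1`, non-wrapping balls only; the gauge is the
print's tree gauge up to the relabelling of the axes (OUR device for the two-point estimate; the print roots the tree at one point and does
not discuss pairs).  Nothing here is summit progress.  Unit `lit-balaban-p30` (literature-prover-lit-balaban-p30-g26-0), HOME
`run/shared/lean/pub/lit-balaban/`, 2026-08-23.
-/

open scoped BigOperators

namespace Literature.MathematicalPhysics.QuantumFieldTheory.BalabanImbrieJaffe1984to88.BIJ85BiCentredAxialGauge

open Literature.MathematicalPhysics.QuantumFieldTheory.Balaban1983to89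
open B7Prop1Explicit (Letter e e_apply hol hol_nil hol_cons stepHol stepHol_true stepHol_false gaugeAct l1 plaqWord axialFn)
open B8Lemma1NonAbelian (lowPart lowPart_apply l1_lowPart_eq)
open B7Prop1Local (hol_plaqWord_eq)
open T4AxialGaugeSmallField (BoxPlaqSmall castSite castSite_apply castSite_add_e pull pull_apply hol_pull_plaqWord_of_lt
  hol_pull_plaqWord_of_gt castSite_injOn_box)
open BIJ85CentredAxialGauge (dist1_axial_bond_le_general lift)
open LatticeFieldCalculus (supDist)
open B3TorusRadialSums (cdist cdist_le_supDist supDist_comm supDist_eq_sup_cdist)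

/-! ## §1  Group level on `ℤ^d`: relabelling the axes -/

section GroupLevel

variable {d : ℕ} {G : Type*}

/-- The site of `ℤ^d` read in relabelled coordinates: `(permSite σ x̃)_κ = x̃_{σ⁻¹κ}` (so that `permSite σ (x ∘ σ) = x`). [folklore] -/
def permSite (σ : Equiv.Perm (Fin d)) (x : Fin d → ℤ) : Fin d → ℤ := fun κ => x (σ.symm κ)

/-- The field read in relabelled coordinates: the bond `⟨x̃, μ⟩` of `permField σ V` is the bond `⟨permSite σ x̃, σμ⟩` of `V`. [folklore] -/
def permField (σ : Equiv.Perm (Fin d)) (V : (Fin d → ℤ) → Fin d → G) : (Fin d → ℤ) → Fin d → G :=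
  fun x μ => V (permSite σ x) (σ μ)

/-- kernel: `permSite` is additive. [cite: Balaban1985Averaging, pp.24–25] -/
theorem permSite_add (σ : Equiv.Perm (Fin d)) (x y : Fin d → ℤ) : permSite σ (x + y) = permSite σ x + permSite σ y := rfl

/-- kernel: `permSite σ e_μ = e_{σμ}`. [cite: Balaban1985Averaging, pp.24–25] -/
theorem permSite_e (σ : Equiv.Perm (Fin d)) (μ : Fin d) : permSite σ (e μ) = e (σ μ) := by
  funext κ
  simp only [permSite, e_apply]
  by_cases h : κ = σ μ
  · subst h; simp
  · rw [if_neg h, if_neg]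
    intro h'; apply h; rw [← h']; simp

/-- kernel: `permSite σ (x ∘ σ) = x`. [cite: Balaban1985Averaging, pp.24–25] -/
theorem permSite_comp (σ : Equiv.Perm (Fin d)) (x : Fin d → ℤ) : permSite σ (x ∘ σ) = x := by
  funext κ; simp [permSite]

/-- kernel: `(x + e_{σμ}) ∘ σ = x ∘ σ + e_μ`. [cite: Balaban1985Averaging, pp.24–25] -/
theorem comp_add_e (σ : Equiv.Perm (Fin d)) (x : Fin d → ℤ) (μ : Fin d) : (x + e (σ μ)) ∘ σ = x ∘ σ + e μ := by
  funext κ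
  simp only [Function.comp_apply, Pi.add_apply, e_apply]
  by_cases h : κ = μ
  · subst h; simp
  · rw [if_neg h, if_neg (fun h' => h (σ.injective h'))]

variable [GaugeGroup G]

/-- **THE PLAQUETTE DICTIONARY OF THE RELABELLING**: `hol (permField σ V) z̃ (∂p_{κμ}) = hol V (permSite σ z̃) (∂p_{σκ,σμ})`. [cite: Balaban1985Averaging, pp.24–25] -/
theorem hol_permField_plaqWord (σ : Equiv.Perm (Fin d)) (V : (Fin d → ℤ) → Fin d → G) (z : Fin d → ℤ) (κ μ : Fin d) :
    hol (permField σ V) z (plaqWord κ μ) = hol V (permSite σ z) (plaqWord (σ κ) (σ μ)) := by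
  rw [hol_plaqWord_eq, hol_plaqWord_eq]
  simp only [permField, permSite_add, permSite_e]

/-- **THE BOX HYPOTHESIS TRANSPORTS**: `BoxPlaqSmall V lo hi a ⟹ BoxPlaqSmall (permField σ V) (lo ∘ σ) (hi ∘ σ) a`. [cite: Balaban1985Averaging, pp.24–25] -/
theorem boxPlaqSmall_permField (σ : Equiv.Perm (Fin d)) {V : (Fin d → ℤ) → Fin d → G} {lo hi : Fin d → ℤ} {a : ℝ}
    (h : BoxPlaqSmall V lo hi a) : BoxPlaqSmall (permField σ V) (lo ∘ σ) (hi ∘ σ) a := by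
  intro z κ μ hκμ hlo hhi
  rw [hol_permField_plaqWord]
  refine h (permSite σ z) (σ κ) (σ μ) (fun h' => hκμ (σ.injective h')) ?_ ?_
  · intro ν
    have := hlo (σ.symm ν)
    simpa [permSite] using this
  · intro ν
    have := hhi (σ.symm ν)
    simp only [Pi.add_apply, Function.comp_apply, Equiv.apply_symm_apply] at this
    simp only [Pi.add_apply, permSite]
    rw [← permSite_e σ κ, ← permSite_e σ μ]
    simpa [permSite] using this

/-- THE TREE-GAUGE FUNCTION ROOTED AT `y` WITH THE AXES RELABELLED BY `σ`: the T4/B7 axial gauge function of the relabelled field, read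
back in the original coordinates. [cite: Balaban1985Averaging, p.24] -/
noncomputable def axialFnPerm (σ : Equiv.Perm (Fin d)) (V : (Fin d → ℤ) → Fin d → G) (y x : Fin d → ℤ) : G :=
  axialFn (permField σ V) (y ∘ σ) (x ∘ σ)

/-- kernel: the gauge action of `axialFnPerm` on the bond `⟨x, σμ⟩` of `V` is the gauge action of the axial gauge on the bond `⟨x∘σ, μ⟩`
of the relabelled field. [cite: Balaban1985Averaging, pp.24–25] -/
theorem gaugeAct_axialFnPerm (σ : Equiv.Perm (Fin d)) (V : (Fin d → ℤ) → Fin d → G) (y x : Fin d → ℤ) (μ : Fin d) :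
    gaugeAct (axialFnPerm σ V y) V x (σ μ) = gaugeAct (axialFn (permField σ V) (y ∘ σ)) (permField σ V) (x ∘ σ) μ := by
  simp only [gaugeAct, axialFnPerm, permField, permSite_comp, comp_add_e]

/-- **THE SHARP TREE-GAUGE BOND BOUND WITH RELABELLED AXES**: in the gauge `axialFnPerm σ V y` every bond `⟨x, x + e_ν⟩` of the box has
`dist1 ≤ (Σ_{κ < σ⁻¹ν} |x_{σκ} − y_{σκ}|)·a` (p344214's `dist1_axial_bond_le_general` for the relabelled field).
[cite: Balaban1985Averaging, pp.24–25] -/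
theorem dist1_axialFnPerm_bond_le (σ : Equiv.Perm (Fin d)) (V : (Fin d → ℤ) → Fin d → G) {lo hi : Fin d → ℤ} {a : ℝ}
    (hP : BoxPlaqSmall V lo hi a) (y x : Fin d → ℤ) (ν : Fin d) (hlo : ∀ κ, lo κ + 1 ≤ min (x κ) (y κ))
    (hhi : ∀ κ, max (x κ) (y κ) + 2 ≤ hi κ) :
    dist1 (gaugeAct (axialFnPerm σ V y) V x ν) ≤ l1 (lowPart (σ.symm ν) ((x - y) ∘ σ)) * a := by
  have h := dist1_axial_bond_le_general (permField σ V) (boxPlaqSmall_permField σ hP) (y ∘ σ) (x ∘ σ) (σ.symm ν)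
    (fun κ => hlo (σ κ)) (fun κ => hhi (σ κ))
  rw [← gaugeAct_axialFnPerm, Equiv.apply_symm_apply] at h
  exact h

/-- kernel: the top index `d − 1` of `Fin d`. [folklore] -/
def topIdx (hd : 0 < d) : Fin d := ⟨d - 1, Nat.sub_lt hd one_pos⟩

/-- kernel: **the last tree direction never enters the bound** — if `|v_κ| ≤ n` for every `κ ≠ top`, then `l1 (lowPart μ v) ≤ (d−1)·n` for
every `μ`. [cite: Balaban1985Averaging, pp.24–25] -/
theorem l1_lowPart_le_offTop (hd : 0 < d) (μ : Fin d) {v : Fin d → ℤ} {n : ℕ} (hn : ∀ κ, κ ≠ topIdx hd → |v κ| ≤ n) :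
    l1 (lowPart μ v) ≤ (d - 1) * n := by
  rw [l1_lowPart_eq]
  have hterm : ∀ κ : Fin d, (if κ < μ then (v κ).natAbs else 0) ≤ if κ = topIdx hd then 0 else n := by
    intro κ
    by_cases hκ : κ = topIdx hd
    · rw [if_pos hκ]
      have : ¬ κ < μ := by
        rw [hκ]; intro hlt
        have h1 : (topIdx hd).val < μ.val := hlt
        simp only [topIdx] at h1
        have := μ.isLt; omega
      rw [if_neg this]
    · rw [if_neg hκ]
      split_ifs
      · have h1 := hn κ hκ
        have : ((v κ).natAbs : ℤ) ≤ n := by rw [Int.natCast_natAbs]; exact h1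
        exact_mod_cast this
      · exact Nat.zero_le _
  calc ∑ κ, (if κ < μ then (v κ).natAbs else 0) ≤ ∑ κ : Fin d, (if κ = topIdx hd then 0 else n) := Finset.sum_le_sum fun κ _ => hterm κ
    _ = (d - 1) * n := by
        rw [Finset.sum_ite, Finset.sum_const_zero, zero_add, Finset.sum_const, smul_eq_mul]
        congr 1
        rw [Finset.filter_ne', Finset.card_erase_of_mem (Finset.mem_univ _), Finset.card_univ, Fintype.card_fin]

end GroupLevel

/-! ## §2  Transport to the torus carrier: the tree gauge of a non-wrapping ball rooted along the axis `i` through the centre -/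

section Torus

variable {P : Params} {j : ℕ} {G : Type*}

open Classical in
/-- The torus gauge transformation of the box `[lo, hi]` built from an ARBITRARY `ℤ^d` gauge function `g`: `g x` at the image of a box point
`x`, `1` off the image of the box (p344214's `axialGaugeAt` is the case `g = axialFn (pull U) y`). [cite: Balaban1985Averaging, p.24] -/
noncomputable def gaugeAtFn [Group G] (g : (Fin P.d → ℤ) → G) (lo hi : Fin P.d → ℤ) : GaugeTransf P j G := fun s =>
  if h : ∃ x : Fin P.d → ℤ, lo ≤ x ∧ x ≤ hi ∧ (castSite x : Balaban1983to89.Site P j) = s then g (Classical.choose h) else 1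

variable [GaugeGroup G]

/-- On a non-wrapping box the torus gauge transformation IS the `ℤ^d` gauge function. [cite: Balaban1985Averaging, pp.24–25] -/
theorem gaugeAtFn_castSite (g : (Fin P.d → ℤ) → G) {lo hi : Fin P.d → ℤ} (hN : ∀ κ, hi κ - lo κ < P.sitesPerDir j)
    {x : Fin P.d → ℤ} (hx : lo ≤ x) (hx' : x ≤ hi) : gaugeAtFn g lo hi (castSite x : Balaban1983to89.Site P j) = g x := by
  have h : ∃ x' : Fin P.d → ℤ, lo ≤ x' ∧ x' ≤ hi ∧ (castSite x' : Balaban1983to89.Site P j) = castSite x := ⟨x, hx, hx', rfl⟩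
  rw [gaugeAtFn, dif_pos h]
  obtain ⟨h1, h2, h3⟩ := Classical.choose_spec h
  rw [castSite_injOn_box hN h1 h2 hx hx' h3]

/-- The torus gauge action of `gaugeAtFn g` on a bond of the box is the `ℤ^d` gauge action of `g` on the pullback. [cite: Balaban1985Averaging, pp.24–25] -/
theorem gaugeAct_gaugeAtFn_castSite (g : (Fin P.d → ℤ) → G) (U : GaugeField P j G) {lo hi : Fin P.d → ℤ}
    (hN : ∀ κ, hi κ - lo κ < P.sitesPerDir j) {x : Fin P.d → ℤ} {μ : Fin P.d} (hx : lo ≤ x) (hxμ : x + e μ ≤ hi) :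
    GaugeField.gaugeAct (gaugeAtFn g lo hi) U ⟨castSite x, μ⟩ = gaugeAct g (pull U) x μ := by
  have hx' : x ≤ hi := (le_add_of_nonneg_right (B8Lemma1NonAbelian.e_nonneg μ)).trans hxμ
  have hlo' : lo ≤ x + e μ := hx.trans (le_add_of_nonneg_right (B8Lemma1NonAbelian.e_nonneg μ))
  simp only [GaugeField.gaugeAct, PBond.tgt, gaugeAct, pull_apply]
  rw [← castSite_add_e, gaugeAtFn_castSite g hN hx hx', gaugeAtFn_castSite g hN hlo' hxμ]

/-- kernel: `castSite (lift x₀) = x₀`. [cite: Balaban1985Averaging, pp.24–25] -/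
theorem castSite_lift (x₀ : Balaban1983to89.Site P j) : (castSite (lift x₀) : Balaban1983to89.Site P j) = x₀ := by
  funext κ
  simp [lift, castSite_apply]

/-- kernel: `|valMinAbs m| = cdist m`. [cite: Balaban1985Averaging, pp.24–25] -/
theorem natAbs_valMinAbs_eq_cdist {n : ℕ} [NeZero n] (m : ZMod n) : m.valMinAbs.natAbs = cdist m := by
  rw [ZMod.valMinAbs_natAbs_eq_min, cdist, ZMod.neg_val]
  split_ifs with h
  · subst h; simp
  · rfl

/-- The pullback box hypothesis from a NON-STRICT plaquette bound on the torus. [cite: Balaban1985Averaging, pp.24–25] -/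
theorem boxPlaqSmall_pull_of_le (U : GaugeField P j G) (lo hi : Fin P.d → ℤ) {δ : ℝ}
    (hU : ∀ p : Balaban1983to89.Plaq P j, dist1 (GaugeField.plaqHol U p) ≤ δ) : BoxPlaqSmall (pull U) lo hi δ := by
  intro z κ μ hκμ _ _
  rcases lt_or_gt_of_ne hκμ with h | h
  · rw [hol_pull_plaqWord_of_lt U z h]; exact hU _
  · rw [hol_pull_plaqWord_of_gt U z h, GaugeGroup.dist1_inv]; exact hU _

/-- **THE TREE GAUGE OF A TORUS BALL ROOTED ALONG THE AXIS `i`** around `x₀` of sup-radius `R`: the axial gauge of the box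
`[x₀ − R − 2, x₀ + R + 2]` (integer lift) rooted at `x₀`, with the axes relabelled by the transposition `i ↔ d−1` so that the FIRST tree
segment runs along `e_i`. [cite: BalabanImbrieJaffe1985, p.326; Balaban1985Averaging, p.24] -/
noncomputable def centredGaugeDir (U : GaugeField P j G) (x₀ : Balaban1983to89.Site P j) (R : ℕ) (i : Fin P.d) : GaugeTransf P j G :=
  gaugeAtFn (axialFnPerm (Equiv.swap i (topIdx (Fin.pos i))) (pull U) (lift x₀))
    (fun κ => lift x₀ κ - (R + 2)) (fun κ => lift x₀ κ + (R + 2))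

/-- **THE BOND DEVIATIONS IN THE AXIS-ROOTED TREE GAUGE ARE CONTROLLED BY THE DISTANCE TO THE AXIS**: if `dist1 (U(∂p)) ≤ δ` for every
plaquette of `T^{(j)}` and `2R + 4 < sitesPerDir j`, then in the gauge `h = centredGaugeDir U x₀ R i` every bond `⟨z, z + e_μ⟩` with
`|z − x₀|_∞ ≤ R` has `dist1 (U^h(⟨z, μ⟩)) ≤ (d − 1)·n·δ` whenever `cdist(z_ν − x₀,ν) ≤ n` for all `ν ≠ i` ([Balaban1985Averaging] p. 25 l. 1–3
read for the tree whose first segment is along `e_i`). [cite: BalabanImbrieJaffe1985, p.326; Balaban1985Averaging, pp.24–25] -/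
theorem dist1_centredGaugeDir_le (U : GaugeField P j G) {δ : ℝ} (hδ : 0 ≤ δ)
    (hU : ∀ p : Balaban1983to89.Plaq P j, dist1 (GaugeField.plaqHol U p) ≤ δ) (x₀ : Balaban1983to89.Site P j) {R : ℕ}
    (hR : 2 * R + 4 < P.sitesPerDir j) (i : Fin P.d) (z : Balaban1983to89.Site P j) (hz : supDist x₀ z ≤ R) (μ : Fin P.d) {n : ℕ}
    (hn : ∀ ν, ν ≠ i → cdist (z ν - x₀ ν) ≤ n) :
    dist1 (GaugeField.gaugeAct (centredGaugeDir U x₀ R i) U ⟨z, μ⟩) ≤ ((P.d - 1 : ℕ) : ℝ) * n * δ := by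
  have hd : 0 < P.d := Fin.pos i
  set σ : Equiv.Perm (Fin P.d) := Equiv.swap i (topIdx hd) with hσ
  -- the integer lift of `z` by least residues of `z − x₀`
  set s : Fin P.d → ℤ := fun κ => (z κ - x₀ κ).valMinAbs with hs
  set zi : Fin P.d → ℤ := lift x₀ + s with hzi
  have hcast : (castSite zi : Balaban1983to89.Site P j) = z := by
    funext κ
    simp only [hzi, hs, lift, castSite_apply, Pi.add_apply, Int.cast_add, Int.cast_natCast, ZMod.natCast_zmod_val,
      ZMod.coe_valMinAbs]
    abel
  have habs : ∀ κ, |s κ| ≤ ((supDist x₀ z : ℕ) : ℤ) := fun κ => by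
    have h1 : (s κ).natAbs ≤ supDist x₀ z := by
      rw [hs, natAbs_valMinAbs_eq_cdist, supDist_comm]
      exact cdist_le_supDist z x₀ κ
    rw [← Int.natCast_natAbs]; exact_mod_cast h1
  have hsz : ∀ κ, |s κ| ≤ (R : ℤ) := fun κ => (habs κ).trans (by exact_mod_cast hz)
  have hN : ∀ κ, (lift x₀ κ + (R + 2)) - (lift x₀ κ - (R + 2)) < P.sitesPerDir j := fun κ => by
    have : ((2 * R + 4 : ℕ) : ℤ) < P.sitesPerDir j := by exact_mod_cast hR
    push_cast at this
    linarith
  have hlo' : (fun κ => lift x₀ κ - (R + 2)) ≤ zi := fun κ => by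
    have h1 := hsz κ; simp only [hzi, Pi.add_apply]; rw [abs_le] at h1; linarith
  have hhi' : zi + e μ ≤ (fun κ => lift x₀ κ + (R + 2)) := fun κ => by
    have h1 := hsz κ; simp only [hzi, Pi.add_apply, e_apply]; rw [abs_le] at h1; split_ifs <;> linarith
  have hlo : ∀ κ, (lift x₀ κ - (R + 2)) + 1 ≤ min (zi κ) (lift x₀ κ) := fun κ => by
    have h1 := hsz κ
    simp only [hzi, Pi.add_apply]
    rw [abs_le] at h1
    refine le_min ?_ ?_ <;> linarith
  have hhi : ∀ κ, max (zi κ) (lift x₀ κ) + 2 ≤ lift x₀ κ + (R + 2) := fun κ => by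
    have h1 := hsz κ
    simp only [hzi, Pi.add_apply]
    rw [abs_le] at h1
    have : max (lift x₀ κ + s κ) (lift x₀ κ) ≤ lift x₀ κ + R := max_le (by linarith) (by linarith)
    linarith
  unfold centredGaugeDir
  rw [← hσ, ← hcast, gaugeAct_gaugeAtFn_castSite _ U hN hlo' hhi']
  have hmain := dist1_axialFnPerm_bond_le σ (pull U) (boxPlaqSmall_pull_of_le U _ _ hU) (lift x₀) zi μ hlo hhi
  refine hmain.trans ?_
  have hv : (zi - lift x₀) ∘ σ = s ∘ σ := by
    have : zi - lift x₀ = s := by rw [hzi]; abel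
    rw [this]
  rw [hv]
  have hl1 : l1 (lowPart (σ.symm μ) (s ∘ σ)) ≤ (P.d - 1) * n := by
    refine l1_lowPart_le_offTop hd (σ.symm μ) fun κ hκ => ?_
    have hκi : σ κ ≠ i := by
      intro h'
      apply hκ
      have : κ = σ.symm i := by rw [← h']; simp
      rw [this, hσ, Equiv.symm_swap, Equiv.swap_apply_left]
    have h1 : (s (σ κ)).natAbs ≤ n := by
      rw [hs, natAbs_valMinAbs_eq_cdist]
      exact hn (σ κ) hκi
    simp only [Function.comp_apply]
    rw [← Int.natCast_natAbs]; exact_mod_cast h1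
  have : (l1 (lowPart (σ.symm μ) (s ∘ σ)) : ℝ) ≤ ((P.d - 1 : ℕ) : ℝ) * n := by exact_mod_cast hl1
  exact mul_le_mul_of_nonneg_right this hδ

/-- **COROLLARY (THE BI-CENTRED FORM)**: for every `x₁` agreeing with `x₀` off the coordinate `i` (a point of the axis), the deviation of
the bond `⟨z, z + e_μ⟩` (`|z − x₀|_∞ ≤ R`) is `≤ (d − 1)·min(|z − x₀|_∞, |z − x₁|_∞)·δ` — linear growth from BOTH points.
[cite: BalabanImbrieJaffe1985, p.326; Balaban1985Averaging, pp.24–25] -/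
theorem dist1_centredGaugeDir_le_min (U : GaugeField P j G) {δ : ℝ} (hδ : 0 ≤ δ)
    (hU : ∀ p : Balaban1983to89.Plaq P j, dist1 (GaugeField.plaqHol U p) ≤ δ) (x₀ : Balaban1983to89.Site P j) {R : ℕ}
    (hR : 2 * R + 4 < P.sitesPerDir j) (i : Fin P.d) {x₁ : Balaban1983to89.Site P j} (hx₁ : ∀ ν, ν ≠ i → x₁ ν = x₀ ν)
    (z : Balaban1983to89.Site P j) (hz : supDist x₀ z ≤ R) (μ : Fin P.d) :
    dist1 (GaugeField.gaugeAct (centredGaugeDir U x₀ R i) U ⟨z, μ⟩) ≤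
      ((P.d - 1 : ℕ) : ℝ) * ((min (supDist x₀ z) (supDist x₁ z) : ℕ) : ℝ) * δ := by
  refine dist1_centredGaugeDir_le U hδ hU x₀ hR i z hz μ fun ν hν => ?_
  refine le_min ?_ ?_
  · rw [← B3TorusRadialSums.cdist_neg, neg_sub]; exact cdist_le_supDist x₀ z ν
  · rw [← hx₁ ν hν, ← B3TorusRadialSums.cdist_neg, neg_sub]; exact cdist_le_supDist x₁ z ν

/-- The same at the centre's own axis point `x₁ = x₀`: p344214's `|·|_∞` form `≤ (d−1)|z − x₀|_∞·δ` for the axis-rooted gauge.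
[cite: BalabanImbrieJaffe1985, p.326; Balaban1985Averaging, pp.24–25] -/
theorem dist1_centredGaugeDir_le_supDist (U : GaugeField P j G) {δ : ℝ} (hδ : 0 ≤ δ)
    (hU : ∀ p : Balaban1983to89.Plaq P j, dist1 (GaugeField.plaqHol U p) ≤ δ) (x₀ : Balaban1983to89.Site P j) {R : ℕ}
    (hR : 2 * R + 4 < P.sitesPerDir j) (i : Fin P.d) (z : Balaban1983to89.Site P j) (hz : supDist x₀ z ≤ R) (μ : Fin P.d) :
    dist1 (GaugeField.gaugeAct (centredGaugeDir U x₀ R i) U ⟨z, μ⟩) ≤ ((P.d - 1 : ℕ) : ℝ) * (supDist x₀ z : ℝ) * δ := by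
  have h := dist1_centredGaugeDir_le_min U hδ hU x₀ hR i (x₁ := x₀) (fun _ _ => rfl) z hz μ
  rwa [min_self] at h

end Torus

end Literature.MathematicalPhysics.QuantumFieldTheory.BalabanImbrieJaffe1984to88.BIJ85BiCentredAxialGauge
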